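import Summits.CriticalPhenomena.PercolationContinuityZ3.Theorems.PercNearOneGluingNoHeavyQuantPkDisplaySchema
import Summits.CriticalPhenomena.PercolationContinuityZ3.Theorems.PercNearOneGluingNoHeavyQuantKnConstantsCertified
import HarnessLib

/-!
# QUANT lane / PAPER-2 rate track (ARM-2 = constants bookkeeper, gen 3): THE BRIDGE `pkLHi ≤ knLHi` —
# every scale of the Kozma–Nitzan cascade is antitone in the Peierls constant, so the Peierls-lever window (`ε = 2⁻⁸`)
# sits inside the tree's window (`ε = 2⁻³²`) and inherits its height count `⌊(log*₂ N − knShiftC d)/2⌋`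

builds on p205010 (kernel theorem, internal audit signed; external expert review pending)

Cell `prim-quant`, seat `prim-quant-arm-2` (constants bookkeeper).  The display schema `…QuantPkDisplaySchema` (p246289) turns a scale
defect `ScaleDefectAt d p_c L (pkTauU d ^ (d·2^d))` along ANY scale function with `m ≤ L m ≤ knLHi d m` into the printed displays
`π_{p_c(ℤ^d)}(N) ≤ (1 − 2^{−a_d})^⌊(log*₂ N − 6)/2⌋`.  This file supplies the two order facts for `L = pkLHi d` (`…QuantPkConstants`,
p244107), for every `d ≥ 1` and every seed `m`:

* `PkSharp.le_pkLHi : m ≤ pkLHi d m`;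
* `PkSharp.pkLHi_le_knLHi : pkLHi d m ≤ knLHi d m` — through the whole cascade: `pkK = 62461 ≤ knK` (p245966 / p211223),
  `knTauU d ≤ pkTauU d` and `knDeltaE d ≤ pkDeltaE d` (closed forms, `2¹⁶·pkK ≤ 2⁶⁴·knK`), hence `uniqScale` (antitone in `τ`),
  `pkM ≤ knM`, `seedBound`/`pkSeeds ≤ knSeeds` (fewer seeds for a larger `δ_E` and a smaller `M`), `Ncont` (monotone in `M, k`),
  `pkRad ≤ knRad` (monotone in `M, k, ℓ`, antitone in the tolerance), `pkR0 ≤ knR0`, `pkA ≤ knA`, `pkLC ≤ knLC`, `pkRC ≤ knRC`,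
  `pkLT ≤ knLT`, `pkRT ≤ knRT`, `pkS ≤ knS`, `pkR ≤ knR`, `pkLHi ≤ knLHi`.

So the moment the Peierls-lever scale defect `ScaleDefectAt d p_c (pkLHi d) (pkTauU d ^ (d·2^d))` lands (arm-1's P5d), the displays of
`…QuantPkDisplaySchema` are one-line instances (`hL := PkSharp.le_pkLHi`, `hLK := PkSharp.pkLHi_le_knLHi hd`).  Pure arithmetic on the
closed-form constants; no probability.  Class of the rate unchanged (iterated logarithm); honest sentence unchanged.
[cite: KozmaNitzan2024, §4 Theorem 6 and Lemmas 10–12 (pp. 17–31)] [cite: DuminilcopinKozmaTassion2020, Proposition 1]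
-/

noncomputable section

namespace Summit.CriticalPhenomena.PercolationContinuityZ3.Theorems.Quant.PkSharp

open Literature.Probability.Percolation Literature.Probability.LatticeModels
open Literature.Probability.Percolation.KozmaNitzan

variable {d : ℕ}

/-! ## The constants: `pkK ≤ knK`, `knDeltaE ≤ pkDeltaE`, `knTauU ≤ pkTauU`, `knDeltaCorr ≤ pkDeltaCorr`, `knDelta ≤ pkDelta` -/

/-- `pkK = 62461 ≤ 3 334 289 807 000 ≤ knK`. [folklore] (numeric) -/
theorem pkK_le_knK : pkK ≤ knK := by
  rw [pkK_eq]; exact le_trans (by norm_num) knK_ge_numeral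

/-- `knEps = 2⁻³² ≤ 2⁻⁸ = pkEps`. [folklore] -/
theorem knEps_le_pkEps : knEps ≤ pkEps := by
  show ((1 : ℝ) / 2) ^ 32 ≤ (1 / 2) ^ 8; norm_num

/-- `knDeltaCorr d ≤ pkDeltaCorr d`. [folklore] -/
theorem knDeltaCorr_le_pkDeltaCorr (d : ℕ) : knDeltaCorr d ≤ pkDeltaCorr d := by
  unfold knDeltaCorr pkDeltaCorr
  exact div_le_div_of_nonneg_right knEps_le_pkEps (by positivity)

/-- `knDelta ≤ pkDelta`. [folklore] -/
theorem knDelta_le_pkDelta : knDelta ≤ pkDelta := by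
  unfold knDelta pkDelta
  exact div_le_div_of_nonneg_right knEps_le_pkEps (by positivity)

/-- `knDeltaE d ≤ pkDeltaE d` (`d ≥ 1`): `1/(2⁶⁴·C·knK) ≤ 1/(2¹⁶·C·pkK)`. [folklore] -/
theorem knDeltaE_le_pkDeltaE (hd : 1 ≤ d) : knDeltaE d ≤ pkDeltaE d := by
  rw [knDeltaE_eq_closedForm hd, pkDeltaE_eq_closedForm hd]
  have hK : (pkK : ℝ) ≤ knK := by exact_mod_cast pkK_le_knK
  have hK0 : (0 : ℝ) < pkK := by exact_mod_cast pkK_pos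
  have hC : (0 : ℝ) < (96 * ((d : ℝ) + 1)) ^ 2 * 200 := by positivity
  apply one_div_le_one_div_of_le (by positivity)
  have h1 : (2 : ℝ) ^ 16 * ((96 * ((d : ℝ) + 1)) ^ 2 * 200) ≤ 2 ^ 64 * ((96 * ((d : ℝ) + 1)) ^ 2 * 200) :=
    mul_le_mul_of_nonneg_right (by norm_num) hC.le
  exact mul_le_mul h1 hK hK0.le (by positivity)

/-- `knTauU d ≤ pkTauU d` (`d ≥ 1`). [folklore] -/
theorem knTauU_le_pkTauU (hd : 1 ≤ d) : knTauU d ≤ pkTauU d := by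
  unfold knTauU pkTauU
  have h := knDeltaE_le_pkDeltaE hd
  have h0 := (knDeltaE_pos d).le
  have : knDeltaE d ^ 2 ≤ pkDeltaE d ^ 2 := pow_le_pow_left₀ h0 h 2
  linarith

/-! ## Generic monotonicity of the scale devices -/

/-- `uniqScale` is antitone in the tolerance: `0 < τ ≤ τ' ⇒ uniqScale d δ τ' m ≤ uniqScale d δ τ m`. [folklore] -/
theorem uniqScale_anti_tol (d : ℕ) (δ : ℝ) {τ τ' : ℝ} (hτ : 0 < τ) (h : τ ≤ τ') (m : ℕ) :
    uniqScale d δ τ' m ≤ uniqScale d δ τ m := by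
  unfold uniqScale
  refine max_le_max le_rfl (max_le_max le_rfl (Nat.ceil_mono ?_))
  have hinv : τ'⁻¹ ≤ τ⁻¹ := inv_anti₀ hτ h
  exact Real.rpow_le_rpow (inv_nonneg.2 (hτ.le.trans h)) hinv (inv_nonneg.2 (AKN.dktAlpha_pos d).le)

/-- `seedBound` is monotone in the scale. [folklore] -/
theorem seedBound_mono (d : ℕ) {M M' : ℕ} (h : M ≤ M') : seedBound d M ≤ seedBound d M' := by
  unfold seedBound
  exact Nat.add_le_add_right (Nat.mul_le_mul_left _ (Nat.pow_le_pow_left (by omega) d)) 1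

/-- `Ncont` is monotone in the scale and in the seed count. [folklore] -/
theorem Ncont_mono (d : ℕ) {M M' k k' : ℕ} (hM : M ≤ M') (hk : k ≤ k') : LData.Ncont d M k ≤ LData.Ncont d M' k' := by
  unfold LData.Ncont LData.Rsep
  exact Nat.mul_le_mul hk (Finset.card_le_card (box_mono d (by omega)))

/-- `critDelta d ≤ 1`. [folklore] -/
theorem critDelta_le_one (d : ℕ) : critDelta d ≤ 1 := (min_le_right _ _).trans (by norm_num)

/-! ## The scales: `pk ≤ kn` all the way up -/

/-- `pkM d m ≤ knM d m` (`d ≥ 1`). [folklore] -/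
theorem pkM_le_knM (hd : 1 ≤ d) (m : ℕ) : pkM d m ≤ knM d m := by
  unfold pkM knM
  have := uniqScale_anti_tol d (critDelta d) (knTauU_pos d) (knTauU_le_pkTauU hd) m
  omega

/-- `pkSeeds d m ≤ knSeeds d m` (`d ≥ 1`): fewer seeds for the larger `δ_E` and the smaller `M`. [folklore] -/
theorem pkSeeds_le_knSeeds (hd : 1 ≤ d) (m : ℕ) : pkSeeds d m ≤ knSeeds d m := by
  unfold pkSeeds knSeeds
  refine Nat.ceil_mono ?_
  have hδ := critDelta_pos hd
  have hδ1 := critDelta_le_one d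
  have hlogkn : Real.log (1 / pkDeltaE d) ≤ Real.log (1 / knDeltaE d) :=
    Real.log_le_log (by have := pkDeltaE_pos d; positivity)
      (one_div_le_one_div_of_le (knDeltaE_pos d) (knDeltaE_le_pkDeltaE hd))
  have hlog0 : 0 ≤ Real.log (1 / knDeltaE d) :=
    Real.log_nonneg (by rw [le_div_iff₀ (knDeltaE_pos d)]; linarith [knDeltaE_lt_one d])
  have hpow : critDelta d ^ seedBound d (knM d m) ≤ critDelta d ^ seedBound d (pkM d m) :=
    pow_le_pow_of_le_one hδ.le hδ1 (seedBound_mono d (pkM_le_knM hd m))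
  exact div_le_div₀ hlog0 hlogkn (pow_pos hδ _) hpow

/-- `pkRad ≤ knRad`: monotone in the hittability scale, antitone in the tolerance (`d ≥ 1`). [folklore] -/
theorem pkRad_le_knRad (hd : 1 ≤ d) (m : ℕ) {ℓ ℓ' : ℕ} (hℓ : ℓ ≤ ℓ') {tol tol' : ℝ} (htol' : 0 < tol') (ht : tol' ≤ tol) :
    pkRad d m ℓ tol ≤ knRad d m ℓ' tol' := by
  unfold pkRad knRad
  have hM := pkM_le_knM hd m
  have hδ := critDelta_pos hd
  have h1 : (1 : ℝ) ≤ 1 / critDelta d := by rw [le_div_iff₀ hδ, one_mul]; exact critDelta_le_one d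
  have hexp : 2 * d * LData.Ncont d (pkM d m) (pkSeeds d m) ≤ 2 * d * LData.Ncont d (knM d m) (knSeeds d m) :=
    Nat.mul_le_mul_left _ (Ncont_mono d hM (pkSeeds_le_knSeeds hd m))
  have hpow : (1 / critDelta d) ^ (2 * d * LData.Ncont d (pkM d m) (pkSeeds d m)) ≤
      (1 / critDelta d) ^ (2 * d * LData.Ncont d (knM d m) (knSeeds d m)) := pow_le_pow_right₀ h1 hexp
  have hceil := Nat.ceil_mono (div_le_div₀ (by positivity) hpow htol' ht)
  omega

/-- `pkR0 d m ≤ knR0 d m` (`d ≥ 1`). [folklore] -/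
theorem pkR0_le_knR0 (hd : 1 ≤ d) (m : ℕ) : pkR0 d m ≤ knR0 d m :=
  pkRad_le_knRad hd m (pkM_le_knM hd m) (knDeltaE_pos d) (knDeltaE_le_pkDeltaE hd)

/-- `pkA d m K ≤ knA d m K'` for `K ≤ K'` (`d ≥ 1`). [folklore] -/
theorem pkA_le_knA (hd : 1 ≤ d) (m : ℕ) {K K' : ℕ} (hK : K ≤ K') : pkA d m K ≤ knA d m K' := by
  unfold pkA knA
  have h0 := pkR0_le_knR0 hd m
  have : 3 * K * pkR0 d m ≤ 3 * K' * knR0 d m := Nat.mul_le_mul (Nat.mul_le_mul_left 3 hK) h0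
  omega

/-- `pkLC d m ≤ knLC d m` (`d ≥ 1`). [folklore] -/
theorem pkLC_le_knLC (hd : 1 ≤ d) (m : ℕ) : pkLC d m ≤ knLC d m :=
  max_le_max (pkM_le_knM hd m) (pkA_le_knA hd m le_rfl)

/-- `pkRC d m ≤ knRC d m` (`d ≥ 1`). [folklore] -/
theorem pkRC_le_knRC (hd : 1 ≤ d) (m : ℕ) : pkRC d m ≤ knRC d m :=
  pkRad_le_knRad hd m (pkLC_le_knLC hd m) (knDeltaCorr_pos d) (knDeltaCorr_le_pkDeltaCorr d)

/-- `pkLT d m ≤ knLT d m` (`d ≥ 1`). [folklore] -/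
theorem pkLT_le_knLT (hd : 1 ≤ d) (m : ℕ) : pkLT d m ≤ knLT d m :=
  max_le_max (pkM_le_knM hd m) (pkA_le_knA hd m (Nat.mul_le_mul_left 2 pkK_le_knK))

/-- `pkRT d m ≤ knRT d m` (`d ≥ 1`). [folklore] -/
theorem pkRT_le_knRT (hd : 1 ≤ d) (m : ℕ) : pkRT d m ≤ knRT d m :=
  pkRad_le_knRad hd m (pkLT_le_knLT hd m) knDelta_pos knDelta_le_pkDelta

/-- `pkS d m ≤ knS d m` (`d ≥ 1`). [folklore] -/
theorem pkS_le_knS (hd : 1 ≤ d) (m : ℕ) : pkS d m ≤ knS d m := by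
  unfold pkS knS
  refine max_le_max (max_le_max ?_ ?_) (max_le_max (pkA_le_knA hd m le_rfl) le_rfl)
  · exact Nat.mul_le_mul_left 2 (pkRT_le_knRT hd m)
  · exact Nat.mul_le_mul_left _ (Nat.add_le_add_right (pkRC_le_knRC hd m) 1)

/-- `pkR d m ≤ knR d m` (`d ≥ 1`). [folklore] -/
theorem pkR_le_knR (hd : 1 ≤ d) (m : ℕ) : pkR d m ≤ knR d m := by
  unfold pkR knR
  exact Nat.mul_le_mul pkK_le_knK (pkS_le_knS hd m)

/-- **THE BRIDGE**: `pkLHi d m ≤ knLHi d m` for every `d ≥ 1` and every seed `m` — the Peierls-lever window sits inside the tree's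
window, so p4's height count `⌊(log*₂ N − knShiftC d)/2⌋ ≤ iterCount (pkLHi d) N` transfers (`PkSharp.logStar_half_le_iterCount_of_le_knLHi`).
builds on p205010 (kernel theorem, internal audit signed; external expert review pending). [folklore] -/
theorem pkLHi_le_knLHi (hd : 1 ≤ d) (m : ℕ) : pkLHi d m ≤ knLHi d m := by
  unfold pkLHi knLHi
  exact Nat.mul_le_mul_left 25 (pkR_le_knR hd m)

/-- `m ≤ pkLHi d m` (every `d`, every `m`). [folklore] -/
theorem le_pkLHi (d m : ℕ) : m ≤ pkLHi d m := (le_pkR d m).trans (by unfold pkLHi; omega)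

/-- `pkM d m ≤ pkLHi d m`. [folklore] -/
theorem pkM_le_pkLHi (d m : ℕ) : pkM d m ≤ pkLHi d m := (pkM_le_pkR d m).trans (by unfold pkLHi; omega)

/-- **The height count of the Peierls-lever window** (`d ≥ 1`): `⌊(log*₂ N − knShiftC d)/2⌋ ≤ iterCount (pkLHi d) N` for every `N`
(p4's sharp count for `knLHi`, p211015, transferred through the bridge; `knShiftC 3 = knShiftC 4 = knShiftC 5 = knShiftC 6 = 6`).
builds on p205010 (kernel theorem, internal audit signed; external expert review pending). [folklore] -/
theorem logStar_half_le_iterCount_pkLHi (hd : 1 ≤ d) (N : ℕ) :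
    (logStar 2 N - knShiftC d) / 2 ≤ iterCount (pkLHi d) N :=
  logStar_half_le_iterCount_of_le_knLHi hd (fun m => le_pkLHi d m) (fun m => pkLHi_le_knLHi hd m) N

end Summit.CriticalPhenomena.PercolationContinuityZ3.Theorems.Quant.PkSharp

end
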